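import Summits.BirchSwinnertonDyer.Rank1Residual.GaloisImage.PrimeChoiceSakamoto
import Summits.BirchSwinnertonDyer.Rank1Residual.GaloisImage.KolyvaginSystemsKummerVanish
import Literature.NumberTheory.EllipticCurves.NonEisensteinPrimeOfSurjective
import HarnessLib

/-!
# `χ(𝓕) = 0 ⟹ KS₁(T̄, 𝓕, 𝒫(τ)) = 0` WITHOUT the prime-choice binder, over any number field
# (cell `b2b-bsdres`, team n1011, row T-C55K, file 6 — general-`K` consumer re-runs; seat p15)

HONEST FRAMING (cell `b2b-bsdres`, run/shared/lean/b2b/bsd-rank1-residual/, verbatim in every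
file): the goal of the cell is to DELETE the COMBINATION-SHAPED residual classes of the
Birch–Swinnerton-Dyer formula for ALL analytic-rank `≤ 1` elliptic curves over `ℚ` — "full BSD
formula for every rank `≤ 1` curve in class `C`" assembled STRICTLY from published theorems — so
that the rank-`≤ 1` remainder becomes exactly the CONSTRUCTION-SHAPED classes, which are TYPED
(missing-input `Prop`s), NOT attempted. This is not "finishing BSD". Team n1011 (N10/N11, the
additive block `X4 ∧ p = 3`): research route; TOOL theorems, no class theorem, nothing booked, no
mark changed; no definition, no named fact.

## What

File 5 (`PrimeChoiceSakamotoTorsion`) re-ran the `ℚ`-instance of R1-16 (n1011-p11's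
`CoreRankZero.kummer_kolyvaginSystems_eq_bot_rat`) with its prime-choice binder `hC55` supplied by
file 4.  This file does the same for the two GENERAL consumers of `hC55` over an arbitrary number
field `K` (at universe `0`, as forced by the tree's Chebotarev `chebotarev_artinRep`, which
quantifies `F : Type`), whenever the Kolyvagin datum's primes ARE Sakamoto's `𝒫(τ)`:

* `kolyvaginSystems_eq_bot_of_hasCoreRank_zero_of_irreducible_of_h3` — p11's
  `CoreRankZero.kolyvaginSystems_eq_bot_of_hasCoreRank_zero_of_selfDual` (Rubin PCMI Thm. 2.7.6 =
  Mazur–Rubin Thm. 4.2.2 at `m = 1`: `χ(𝓕) = 0 ⟹ KS₁(T̄, 𝓕, 𝒫) = 0`, any finite `T̄` killed by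
  `p`, any `𝓕`, the dual classes transported by an `H¹`-injective `θ' : T̄^∨(1) → T̄`) with
  `hC55` REPLACED by: `D.primes = frobeniusClassPrimes ρ S' τ N` (`S'` finite, `N ≠ 0`),
  `T̄/(τ − 1)T̄ ≃ ℤ/p`, `3 ≤ p`, (H.1) `hirr`, (H.3) `hH3` (tree shapes).
* `kummer_kolyvaginSystems_eq_bot_of_hasSurjectiveModNGaloisRep_of_h3` — p11's FILE 5
  `CoreRankZero.kummer_kolyvaginSystems_eq_bot` (`T̄ = E[p]` over a number field `K`, classical
  Kummer structure, `p` odd) with `hC55` REPLACED by `ρ̄_{E,p}` onto (⟹ (H.1),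
  `hasIrreducibleModPGaloisRep_of_hasSurjectiveModNGaloisRep`) + the (H.3) binder (discharged over
  `ℚ` by `hH3_self_of_hasSurjectiveModNGaloisRep`; over a general `K` it stays the displayed
  hypothesis of `InflationRestrictionSakamotoH3`'s shape) + `D.primes = 𝒫(τ)`, `E[p]/(τ − 1) ≃ ℤ/p`.

Both are partial applications of p11's theorems to file 4's
`infinite_setOf_mem_frobeniusClassPrimes_localization_ne_zero_three` — the kernel's check that the
discharged binder has literally the shape `hC55`.

References: R. Sakamoto, JTNB 36 (2024), Cor. 5.5 (p. 929); K. Rubin, PCMI 18 (2011), Thm. 2.7.6;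
B. Mazur, K. Rubin, Mem. AMS 799 (2004), Thm. 4.2.2 and Prop. 3.6.1.
-/

noncomputable section

open scoped Classical NumberField ContRepresentation
open Function Field NumberField IsDedekindDomain WeierstrassCurve
open Literature.NumberTheory.EllipticCurves
open Literature.NumberTheory.GaloisRepresentations Literature.NumberTheory.GaloisRepresentations.DiscreteGaloisModule
open Literature.NumberTheory.GaloisCohomology

namespace Summit.BirchSwinnertonDyer.Rank1Residual.GaloisImage.PrimeChoice

variable {K : Type} [Field K] [NumberField K]

section General

variable {M : Type} [AddCommGroup M] [TopologicalSpace M] [DiscreteTopology M] [Finite M]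
  {ρ : DiscreteGaloisModule K M}

/-- **`χ(𝓕) = 0 ⟹ KS₁(T̄, 𝓕, 𝒫(τ)) = 0` on Sakamoto's primes, WITHOUT the prime-choice binder.**
n1011-p11's `CoreRankZero.kolyvaginSystems_eq_bot_of_hasCoreRank_zero_of_selfDual` (Rubin PCMI
Thm. 2.7.6 / Mazur–Rubin Thm. 4.2.2 at `m = 1`) for a Kolyvagin datum whose primes are
`frobeniusClassPrimes ρ S' τ N` (`S'` finite, `N ≠ 0`, `T̄/(τ − 1)T̄ ≃ ℤ/p`, `3 ≤ p`), with the
hypothesis `hC55` ([S24] Cor. 5.5) SUPPLIED by file 4 from (H.1) `hirr` and (H.3) `hH3`.  All other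
hypotheses verbatim as in p11's theorem.
[cite: Rubin2011, Thm. 2.7.6 (p. 24)] [cite: Sakamoto2024, Cor. 5.5 (p. 929)] -/
theorem kolyvaginSystems_eq_bot_of_hasCoreRank_zero_of_irreducible_of_h3 {p : ℕ} [Fact p.Prime]
    (hp : 3 ≤ p) {inv : LocalInvariants K p}
    (hperf : inv.IsPerfect) (hsum : inv.SumLocalTermEqZero) (hcompl : inv.SelmerComplement)
    (hM : ∀ m : M, p • m = 0) {S : Finset (Place K)}
    (hS : ∀ v : HeightOneSpectrum (𝓞 K), (Sum.inr v : Place K) ∉ S →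
      ((p : ℕ) : 𝓞 K) ∉ v.asIdeal ∧ GaloisRep.IsUnramifiedAt v ρ)
    {𝓕 : SelmerStructure ρ} (h𝓕 : 𝓕.IsUnramifiedOutside S)
    (hfin : Finite 𝓕.selmerGroup) (hfind : Finite (inv.dualSelmerStructure ρ 𝓕).selmerGroup)
    (hχ : LocalInvariants.HasCoreRank inv 𝓕 p 0)
    {D : KolyvaginDatum ρ} (hPS : ∀ q ∈ D.primes, (Sum.inr q : Place K) ∉ S)
    (hadm : D.IsAdmissible)
    (hU : ∀ q ∈ D.primes, Nat.card (unramifiedSubgroup (GaloisRep.toLocal q ρ) 1) = p)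
    (hT : ∀ q ∈ D.primes, Nat.card (D.transverse (Sum.inr q)) = p)
    (hUT : ∀ q ∈ D.primes,
      unramifiedSubgroup (GaloisRep.toLocal q ρ) 1 ⊔ D.transverse (Sum.inr q) = ⊤)
    (θ' : (ρ.tateDual p).toContRepresentation →ⁱL ρ.toContRepresentation)
    (hθ' : Injective (galoisCohomology.map θ' 1))
    {S' : Set (HeightOneSpectrum (𝓞 K))} (hS' : S'.Finite) {τ : absoluteGaloisGroup K} {N : ℕ}
    (hN : N ≠ 0) (hP : D.primes = frobeniusClassPrimes ρ S' τ N)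
    (hτ : Nonempty (cokerSubOne ρ τ ≃+ ZMod p))
    (hirr : ∀ A : AddSubgroup M,
      (∀ (s : absoluteGaloisGroup K), ∀ m ∈ A, ρ s m ∈ A) → A = ⊥ ∨ A = ⊤)
    (hH3 : ∀ f : contOneCocycles ρ.toTopRep,
      (∀ u : absoluteGaloisGroup K, ρ u = 1 → u ∈ rootsOfUnityFixer K N → f.1 u = 0) →
        oneCocycleClass ρ.toTopRep f = 0) :
    D.kolyvaginSystems 𝓕 = ⊥ :=
  CoreRankZero.kolyvaginSystems_eq_bot_of_hasCoreRank_zero_of_selfDual hperf hsum hcompl hM hS h𝓕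
    hfin hfind hχ hPS hadm hU hT hUT θ' hθ'
    (hP ▸ infinite_setOf_mem_frobeniusClassPrimes_localization_ne_zero_three ρ hp hN S' hS' hτ
      hirr hH3)

end General

section Torsion

/-- **`KS₁(E[p], 𝓚, 𝒫(τ)) = 0` over a number field `K`, `p` odd, `ρ̄_{E,p}` onto — WITHOUT the
prime-choice binder.**  n1011-p11's `CoreRankZero.kummer_kolyvaginSystems_eq_bot` (R1-16 FILE 5)
for a Kolyvagin datum on `frobeniusClassPrimes (E[p]) S' τ p` with `hC55` SUPPLIED by file 4:
(H.1) from surjectivity (`hasIrreducibleModPGaloisRep_of_hasSurjectiveModNGaloisRep`); (H.3) is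
kept as the displayed binder `hH3` (over `ℚ` it is `hH3_self_of_hasSurjectiveModNGaloisRep`, see
file 5's `kummer_kolyvaginSystems_eq_bot_rat_of_hasSurjectiveModNGaloisRep`).
[cite: Rubin2011, Thm. 2.7.6 (p. 24)] [cite: Sakamoto2024, Cor. 5.5 (p. 929)] -/
theorem kummer_kolyvaginSystems_eq_bot_of_hasSurjectiveModNGaloisRep_of_h3
    (W : WeierstrassCurve K) [W.IsElliptic]
    (p : ℕ) [Fact p.Prime] (hp2 : p ≠ 2) [Finite (geomTorsion W (p : ℤ))]
    (hsurj : W.HasSurjectiveModNGaloisRep (p : ℤ))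
    {inv : LocalInvariants K p}
    (hperf : inv.IsPerfect) (hsum : inv.SumLocalTermEqZero) (hcompl : inv.SelmerComplement)
    (hEP : ∀ v : HeightOneSpectrum (𝓞 K), localEulerPoincareCharacteristic (v.adicCompletion K))
    {S : Finset (Place K)}
    (hS : ∀ v : HeightOneSpectrum (𝓞 K), (Sum.inr v : Place K) ∉ S →
      ((p : ℕ) : 𝓞 K) ∉ v.asIdeal ∧ GaloisRep.IsUnramifiedAt v (W.torsionGaloisModule (p : ℤ)))
    (h𝓚 : (W.kummerSelmerStructure (p : ℤ)).IsUnramifiedOutside S)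
    [hfin : Finite (W.kummerSelmerStructure (p : ℤ)).selmerGroup]
    {D : KolyvaginDatum (W.torsionGaloisModule (p : ℤ))}
    (hPS : ∀ q ∈ D.primes, (Sum.inr q : Place K) ∉ S) (hadm : D.IsAdmissible)
    (hU : ∀ q ∈ D.primes,
      Nat.card (unramifiedSubgroup (GaloisRep.toLocal q (W.torsionGaloisModule (p : ℤ))) 1) = p)
    (hT : ∀ q ∈ D.primes, Nat.card (D.transverse (Sum.inr q)) = p)
    (hUT : ∀ q ∈ D.primes,
      unramifiedSubgroup (GaloisRep.toLocal q (W.torsionGaloisModule (p : ℤ))) 1 ⊔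
        D.transverse (Sum.inr q) = ⊤)
    {S' : Set (HeightOneSpectrum (𝓞 K))} (hS' : S'.Finite) {τ : absoluteGaloisGroup K}
    (hP : D.primes = frobeniusClassPrimes (W.torsionGaloisModule (p : ℤ)) S' τ p)
    (hτ : Nonempty (cokerSubOne (W.torsionGaloisModule (p : ℤ)) τ ≃+ ZMod p))
    (hH3 : ∀ f : contOneCocycles (W.torsionGaloisModule (p : ℤ)).toTopRep,
      (∀ u : absoluteGaloisGroup K, (W.torsionGaloisModule (p : ℤ)) u = 1 →
        u ∈ rootsOfUnityFixer K p → f.1 u = 0) →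
        oneCocycleClass (W.torsionGaloisModule (p : ℤ)).toTopRep f = 0) :
    D.kolyvaginSystems (W.kummerSelmerStructure (p : ℤ)) = ⊥ := by
  have hprime : p.Prime := Fact.out
  haveI : NeZero (p : K) := ⟨Nat.cast_ne_zero.mpr hprime.ne_zero⟩
  have hp3 : 3 ≤ p := by
    rcases hprime.eq_two_or_odd' with h | h
    · exact absurd h hp2
    · have := hprime.two_le; omega
  have hirr := hasIrreducibleModPGaloisRep_of_hasSurjectiveModNGaloisRep W p hsurj
  exact CoreRankZero.kummer_kolyvaginSystems_eq_bot W p hp2 hperf hsum hcompl hEP hS h𝓚 hPS hadm hU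
    hT hUT
    (hP ▸ infinite_setOf_mem_frobeniusClassPrimes_localization_ne_zero_three
      (W.torsionGaloisModule (p : ℤ)) hp3 hprime.ne_zero S' hS' hτ
      (fun A hA => hirr A fun σ P hP' => hA σ P hP') hH3)

end Torsion

end Summit.BirchSwinnertonDyer.Rank1Residual.GaloisImage.PrimeChoice

end
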